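import Mathlib
import HarnessLib
import Summits.HubbardSuperconductivity.HubbardSuperconductivity.Theorems.KLProgrammeC4aCausticOffsetRate
import Summits.HubbardSuperconductivity.HubbardSuperconductivity.Theorems.KLProgrammeC4aPartnerBandChartPoint

/-!
# Route `KLProgramme` — crux C4a, S3 brick (B4) «(B4)-UMK1», «(M4)-COVER»: the WINDOW CLASSIFICATION of the umklapp first-order ϑ-layer — a NEAR-CAUSTIC box on an
# umklapp sheet is, by the Gauss-law trichotomy on the angle of `q′` against the loop angle, EMPTY (same direction), TRANSVERSAL (a signed configuration-rate
# floor on the whole box ⟹ the two-point separation of the caustic offset) or ANTIPODAL (the three rows of the convex window after a `2π`-shift of the loop window)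

Cell `gate-hubbard-kl`, seat hubbard-kl-k3c3-p3 (g30; row «implicit-function / monotonicity route for μ(n)»).  Located brick for the (C)-closer lane hubbard-kl-c4a-1
(stub (C) `stub_twoLeg_curvature` of `KLRegimeEngineV17F2`, stmt-HubbardSuperconductivity-20437), memo HOME/hubbard-kl-k3c3-p3/U1-CAUSTIC-SUP.md §9 (3) — the one
piece of the (M4) call graph that was not typed («the window classification (a)/(b)/(c) as a cover lemma with explicit `η, ω, d₁`»).

Objects (per base angle `θ`, radius `|ρ| < r`, base point `c : Momentum` — for the umklapp sheet `m` of the pp loop `c = Φ(0,θ) − 2πm`): the partner-band family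
`g(ϑ,φ) = e_K(c + Φ(ρ,ϑ+θ) − Φ(0,φ+θ))` on a box `[α,β] × [φa,φb]`, its configuration rate `R(ϑ,φ) = De_K(c + Φ(ρ,ϑ+θ) − Φ(0,φ+θ))[∂_sΦ(ρ,ϑ+θ)]`, a reference
loop angle `ψ` with `‖c + Φ(ρ,ϑ+θ) − Φ(0,φ+θ) − Φ(0,ψ)‖ ≤ Δ` on the box (the `hΔ` row of `…C4aCausticWindowDispatchPartnerBand`).
* §1 torus bookkeeping: representatives (`exists_int_abs_sub_two_pi_mul_le_of_torusDist_le`), subadditivity, the `min(‖·‖_𝕋, ‖· − π‖_𝕋)` control, `Φ(ρ, s + 2πj) = Φ(ρ,s)`,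
  the `2π`-shift of a loop window (`exists_shift_of_torusDist_antipodal`, `partnerBand_rows_shift`, `sInf_partnerBand_image_Icc_add_shift`);
* §2 **the near-caustic box**: a witness `‖S(ϑ₁) − v − 2Φ(0,φ₁+θ)‖ ≤ τ₀` at one configuration gives the `hΔ` row on the whole box with `ψ = φ₁ + θ`,
  `Δ = τ₀ + msD₁·((β − α) + (φb − φa))` (`norm_partnerBand_sub_loopPoint_le_of_nearCaustic`);
* §3 **SAME DIRECTION IS EMPTY on umklapp sheets** (`not_nearCaustic_sameDirection`): `m ≠ 0`, `‖ϑ₁ − φ₁‖_𝕋 ≤ η₀` and `τ₀ + 2(msD₁·η₀ + |ρ|/(Dt−2A)) ≤ 3/5` contradict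
  the 3/5 margin `lt_caustic_dist_add_two_norm_sub` of `…C4aCausticOffsetRate` §5;
* §4 **TRANSVERSAL (floor)**: from the `hΔ` row alone (`Δ ≤ 3/10`, `K₁Δ < r`) the partner is the DIRECT chart point of its own level
  (`exists_levelPoint_eq_of_abs_frameLevel_lt`), `|ē| ≤ K₁Δ`, its chart angle within `(π/(2u_min))Δ` of `ψ` (lower chord bound), so the Gauss law
  `abs_fderiv_frameLevel_levelPoint_tangent_ge` gives **`abs_configRate_ge_of_near`**:
  `κ(η) := (2/π)(Dt−2A)u_min·((u_min w/(4+2A))(η − (π/(2u_min))Δ) − πKc(K₁Δ + |ρ|)/(Dt−2A)²) ≤ |R(ϑ,φ)|` whenever `η ≤ min(‖ψ − (ϑ+θ)‖_𝕋, ‖ψ − (ϑ+θ) − π‖_𝕋)`;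
  the companion `…C4aCausticWindowCoverTransversal` turns this floor (with `κ > 0` on a box) into ONE SIGN of the rate and the two-point separation
  `κ|ϑ − ϑ′| ≤ |δ₀(ϑ) − δ₀(ϑ′)|` of the window minimum — the `hsep` of `…C4aCausticWindowDispatchTransversal`;
* §5 **ANTIPODAL**: `‖ϑ₁ + θ − ψ − π‖_𝕋 ≤ η₀` ⟹ an integer `j` with `|ϑ + θ − (ψ + 2πj + π)| ≤ η₀ + (β − α)` on `[α,β]` (`exists_shift_of_torusDist_antipodal`); the rows
  `hΔ`, `hω₂` transport to `ψ′ = ψ + 2πj` and the shifted loop window `[φa + 2πj, φb + 2πj]`, and the canonical offset is shift-invariant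
  (`sInf_partnerBand_image_Icc_add_shift`) — the inputs of `…C4aCausticWindowDispatchPartnerBand.intervalIntegral_caustic_dispatch_partnerBand_sInf_le`.
Companions: `…C4aCausticWindowCoverTransversal` (the separation), `…C4aCausticWindowCoverDispatch` (per-window wrappers, the COVER theorem).  Sizes binder shape (+ `GeomConstants` = `FrameOK` (i), + `K₁`);
pure geometry/bookkeeping on landed rows; nothing about the model's sizes; nothing asserts (C), K3 or superconductivity.
References: BGM 2003 §7.1 Lemma 7.1 (A1.9) [cite: BenfattoGiulianiMastropietro2003]; FST II CPAM 51 (1998) §2.1, §3 [cite: FeldmanSalmhoferTrubowitz1998].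
-/

noncomputable section

namespace Summit.HubbardSuperconductivity.HubbardSuperconductivity.Theorems.C4a

set_option linter.dupNamespace false -- summit = problem name (single-conjunct summit), D-0017

open Real Set
open Literature.MathematicalPhysics.QuantumLattice Literature.MathematicalPhysics.QuantumLattice.BandSectorCounting
open Literature.MathematicalPhysics.QuantumLattice.FermiRG
open Summit.HubbardSuperconductivity.HubbardSuperconductivity.Theorems.KLRegimeSplit
open Summit.HubbardSuperconductivity.HubbardSuperconductivity.Theorems.DispersionFlow
open Summit.HubbardSuperconductivity.HubbardSuperconductivity.Theorems.PerturbedFermiCurve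

/-! ## §1 Torus bookkeeping -/

/-- A representative: `‖x‖_𝕋 ≤ η ⟹ |x − 2πj| ≤ η` for some `j ∈ ℤ`. -/
theorem exists_int_abs_sub_two_pi_mul_le_of_torusDist_le {x η : ℝ} (h : torusDist x ≤ η) : ∃ j : ℤ, |x - 2 * π * j| ≤ η := by
  obtain ⟨k, hk⟩ := exists_torusDist_eq_abs x
  refine ⟨-k, ?_⟩
  rw [show x - 2 * π * ((-k : ℤ) : ℝ) = x + k * (2 * π) by push_cast; ring, ← hk]
  exact h

/-- Subadditivity of the torus distance: `‖x + y‖_𝕋 ≤ ‖x‖_𝕋 + ‖y‖_𝕋`. -/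
theorem torusDist_add_le_torusDist_add (x y : ℝ) : torusDist (x + y) ≤ torusDist x + torusDist y := by
  unfold FermiRG.torusDist
  rw [AddCircle.coe_add]
  exact norm_add_le _ _

/-- `‖x + y‖_𝕋 ≤ ‖x‖_𝕋 + |y|`. -/
theorem torusDist_add_le_torusDist_add_abs (x y : ℝ) : torusDist (x + y) ≤ torusDist x + |y| :=
  (torusDist_add_le_torusDist_add x y).trans (by have := torusDist_le_abs_self y; linarith)

/-- `‖x‖_𝕋 − ‖y‖_𝕋 ≤ ‖x + y‖_𝕋`. -/
theorem torusDist_sub_torusDist_le_torusDist_add (x y : ℝ) : torusDist x - torusDist y ≤ torusDist (x + y) := by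
  have h := torusDist_add_le_torusDist_add (x + y) (-y)
  rw [add_neg_cancel_right, torusDist_neg'] at h
  linarith

/-- **The `min(‖·‖_𝕋, ‖· − π‖_𝕋)` control**: moving the argument by `y` costs at most `‖y‖_𝕋`. -/
theorem min_torusDist_add_ge (x y : ℝ) :
    min (torusDist x) (torusDist (x - π)) - torusDist y ≤ min (torusDist (x + y)) (torusDist (x + y - π)) := by
  have h1 := torusDist_sub_torusDist_le_torusDist_add x y
  have h2 := torusDist_sub_torusDist_le_torusDist_add (x - π) y
  rw [show x - π + y = x + y - π by ring] at h2
  have m1 := min_le_left (torusDist x) (torusDist (x - π))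
  have m2 := min_le_right (torusDist x) (torusDist (x - π))
  exact le_min (by linarith) (by linarith)

/-- The same with a real displacement: costs at most `|y|`. -/
theorem min_torusDist_add_ge_abs (x y : ℝ) :
    min (torusDist x) (torusDist (x - π)) - |y| ≤ min (torusDist (x + y)) (torusDist (x + y - π)) :=
  le_trans (by have := torusDist_le_abs_self y; linarith) (min_torusDist_add_ge x y)

/-- `Φ(ρ, s + 2πj) = Φ(ρ, s)` for every integer `j`. -/
theorem levelPoint_add_int_mul_two_pi (μ : ℝ) (K : TrigPolyC4v) (ρ s : ℝ) (j : ℤ) :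
    levelPoint μ K ρ (s + 2 * π * j) = levelPoint μ K ρ s := by
  have hper : ∀ (x : ℝ) (n : ℕ), levelPoint μ K ρ (x + 2 * π * n) = levelPoint μ K ρ x := by
    intro x n
    induction n with
    | zero => simp
    | succ n ih => rw [Nat.cast_succ, mul_add, mul_one, ← add_assoc, levelPoint_add_two_pi, ih]
  obtain ⟨n, rfl | rfl⟩ := j.eq_nat_or_neg
  · exact_mod_cast hper s n
  · have h := hper (s + 2 * π * ((-(n : ℤ) : ℤ) : ℝ)) n
    have e : s + 2 * π * ((-(n : ℤ) : ℤ) : ℝ) + 2 * π * (n : ℝ) = s := by push_cast; ring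
    rw [e] at h
    exact h.symm

/-! ### The `2π`-shift of a loop window (used by the antipodal alternative, §5) -/

/-- **THE SHIFT**: if the angle `ϑ₁ + θ` of `q′` is within `η₀` of `ψ + π` on the torus for some `ϑ₁ ∈ [α,β]`, then for an integer `j`, on the whole window
`|ϑ + θ − (ψ + 2πj + π)| ≤ η₀ + (β − α)` — the `hω₁` row for the shifted reference angle `ψ + 2πj`. -/
theorem exists_shift_of_torusDist_antipodal {α β ϑ₁ θ ψ η₀ : ℝ} (hϑ₁ : ϑ₁ ∈ Icc α β) (hanti : torusDist (ϑ₁ + θ - ψ - π) ≤ η₀) :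
    ∃ j : ℤ, ∀ ϑ ∈ Icc α β, |ϑ + θ - (ψ + 2 * π * j + π)| ≤ η₀ + (β - α) := by
  obtain ⟨j, hj⟩ := exists_int_abs_sub_two_pi_mul_le_of_torusDist_le hanti
  refine ⟨j, fun ϑ hϑ => ?_⟩
  have h1 : |ϑ - ϑ₁| ≤ β - α := abs_sub_le_iff.2 ⟨by linarith [hϑ.2, hϑ₁.1], by linarith [hϑ.1, hϑ₁.2]⟩
  have e : ϑ + θ - (ψ + 2 * π * j + π) = (ϑ - ϑ₁) + (ϑ₁ + θ - ψ - π - 2 * π * j) := by ring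
  rw [e]
  exact (abs_add_le _ _).trans (by linarith)

/-- **THE ROWS TRANSPORT UNDER THE SHIFT**: the `hΔ` row and the loop-proximity row `hω₂` for `(ψ, [φa,φb])` give the same rows for `(ψ + 2πj, [φa + 2πj, φb + 2πj])`. -/
theorem partnerBand_rows_shift {μ : ℝ} {K : TrigPolyC4v} (ρ : ℝ) (c : Momentum) (θ ψ : ℝ) (j : ℤ) {α β φa φb Δ ω₂ : ℝ}
    (hΔ : ∀ x ∈ Icc α β ×ˢ Icc φa φb, ‖c + (levelPoint μ K ρ (x.1 + θ) - levelPoint μ K 0 (x.2 + θ)) - levelPoint μ K 0 ψ‖ ≤ Δ)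
    (hω₂ : ∀ φ ∈ Icc φa φb, |φ + θ - ψ| ≤ ω₂) :
    (∀ x ∈ Icc α β ×ˢ Icc (φa + 2 * π * j) (φb + 2 * π * j),
        ‖c + (levelPoint μ K ρ (x.1 + θ) - levelPoint μ K 0 (x.2 + θ)) - levelPoint μ K 0 (ψ + 2 * π * j)‖ ≤ Δ) ∧
      ∀ φ ∈ Icc (φa + 2 * π * j) (φb + 2 * π * j), |φ + θ - (ψ + 2 * π * j)| ≤ ω₂ := by
  constructor
  · intro x hx
    have hx2 : x.2 - 2 * π * j ∈ Icc φa φb := ⟨by linarith [hx.2.1], by linarith [hx.2.2]⟩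
    have h := hΔ (x.1, x.2 - 2 * π * j) ⟨hx.1, hx2⟩
    have e1 : levelPoint μ K 0 (x.2 + θ) = levelPoint μ K 0 (x.2 - 2 * π * j + θ) := by
      rw [← levelPoint_add_int_mul_two_pi μ K 0 (x.2 - 2 * π * j + θ) j]; ring_nf
    rw [levelPoint_add_int_mul_two_pi, e1]
    exact h
  · intro φ hφ
    have h := hω₂ (φ - 2 * π * j) ⟨by linarith [hφ.1], by linarith [hφ.2]⟩
    rw [show φ + θ - (ψ + 2 * π * j) = φ - 2 * π * j + θ - ψ by ring]
    exact h

/-- **THE CANONICAL OFFSET IS SHIFT-INVARIANT**: `inf_{φ ∈ [φa + 2πj, φb + 2πj]} e_K(c + Φ(ρ,ϑ+θ) − Φ(0,φ+θ)) = inf_{φ ∈ [φa,φb]} …` (the loop is `2π`-periodic). -/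
theorem sInf_partnerBand_image_Icc_add_shift {μ : ℝ} {K : TrigPolyC4v} (ρ : ℝ) (c : Momentum) (θ ϑ φa φb : ℝ) (j : ℤ) :
    sInf ((fun φ => frameLevel μ K (c + (levelPoint μ K ρ (ϑ + θ) - levelPoint μ K 0 (φ + θ)))) '' Icc (φa + 2 * π * j) (φb + 2 * π * j)) =
      sInf ((fun φ => frameLevel μ K (c + (levelPoint μ K ρ (ϑ + θ) - levelPoint μ K 0 (φ + θ)))) '' Icc φa φb) := by
  congr 1
  rw [← Set.image_add_const_Icc (2 * π * (j : ℝ)) φa φb, Set.image_image]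
  refine Set.image_congr fun φ _ => ?_
  show frameLevel μ K (c + (levelPoint μ K ρ (ϑ + θ) - levelPoint μ K 0 (φ + 2 * π * j + θ))) =
    frameLevel μ K (c + (levelPoint μ K ρ (ϑ + θ) - levelPoint μ K 0 (φ + θ)))
  rw [show φ + 2 * π * j + θ = φ + θ + 2 * π * j by ring, levelPoint_add_int_mul_two_pi]

/-! ## §2–§5 The near-caustic box on an umklapp sheet -/

section Sizes

variable {K : TrigPolyC4v} {A : ℝ} (hA : ∀ p : Momentum, ∀ j ≤ 2, ‖iteratedFDeriv ℝ j (frameShift K) p‖ ≤ A) (hA20 : A ≤ 1 / 20)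
  (hd : klCurveD ≤ (bandBounds (show (-4 : ℝ) < -1.1 by norm_num) (show (-1.1 : ℝ) ≤ -0.1 by norm_num)
    (show (-0.1 : ℝ) < 0 by norm_num)).Dtmin - 2 * A)
  {μ r : ℝ} (hr : 0 < r) (hlo : (-1.1 : ℝ) < μ - r - A) (hhi : μ + r + A < -0.1)
  {A₃ A₄ : ℝ} (hA₃ : ∀ p : Momentum, ‖iteratedFDeriv ℝ 3 (frameShift K) p‖ ≤ A₃)
  (hA₄ : ∀ p : Momentum, ‖iteratedFDeriv ℝ 4 (frameShift K) p‖ ≤ A₄)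
  {K₁ : ℝ} (hK₁ : ∀ p : Momentum, ‖fderiv ℝ (frameLevel μ K) p‖ ≤ K₁)
include hA hA20 hd hr hlo hhi hA₃ hA₄ hK₁

/-! ### §2 The `hΔ` row of a near-caustic box -/

omit hr hK₁ in
/-- **THE `hΔ` ROW OF A NEAR-CAUSTIC BOX.**  `|ρ| < r`, base point `c`, base angle `θ`; a witness configuration `(ϑ₁, φ₁)` with
`‖c + Φ(ρ,ϑ₁+θ) − Φ(0,φ₁+θ) − Φ(0,φ₁+θ)‖ ≤ τ₀` (for `c = Φ(0,θ) − v` this is `‖S(ϑ₁) − v − 2Φ(0,φ₁+θ)‖ ≤ τ₀`: within `τ₀` of the caustic of the sheet `v`).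
THEN at every `(ϑ, φ)`: `‖c + Φ(ρ,ϑ+θ) − Φ(0,φ+θ) − Φ(0,φ₁+θ)‖ ≤ τ₀ + msD₁·|ϑ − ϑ₁| + msD₁·|φ − φ₁|` — the `hΔ` row with reference angle `ψ = φ₁ + θ`. -/
theorem norm_partnerBand_sub_loopPoint_le_of_nearCaustic {ρ : ℝ} (hρ : |ρ| < r) (c : Momentum) (θ : ℝ) {ϑ₁ φ₁ τ₀ : ℝ}
    (hτ : ‖c + (levelPoint μ K ρ (ϑ₁ + θ) - levelPoint μ K 0 (φ₁ + θ)) - levelPoint μ K 0 (φ₁ + θ)‖ ≤ τ₀) (ϑ φ : ℝ) :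
    ‖c + (levelPoint μ K ρ (ϑ + θ) - levelPoint μ K 0 (φ + θ)) - levelPoint μ K 0 (φ₁ + θ)‖ ≤
      τ₀ + msD A₃ A₄ 1 * |ϑ - ϑ₁| + msD A₃ A₄ 1 * |φ - φ₁| := by
  have h0 : |(0 : ℝ)| < r := by simpa using lt_of_le_of_lt (abs_nonneg ρ) hρ
  have h1 := norm_levelPoint_sub_le_abs hA hA20 hd hlo hhi hA₃ hA₄ hρ (ϑ + θ) (ϑ₁ + θ)
  have h2 := norm_levelPoint_sub_le_abs hA hA20 hd hlo hhi hA₃ hA₄ h0 (φ + θ) (φ₁ + θ)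
  rw [show ϑ + θ - (ϑ₁ + θ) = ϑ - ϑ₁ by ring] at h1
  rw [show φ + θ - (φ₁ + θ) = φ - φ₁ by ring] at h2
  have hid : c + (levelPoint μ K ρ (ϑ + θ) - levelPoint μ K 0 (φ + θ)) - levelPoint μ K 0 (φ₁ + θ) =
      (c + (levelPoint μ K ρ (ϑ₁ + θ) - levelPoint μ K 0 (φ₁ + θ)) - levelPoint μ K 0 (φ₁ + θ)) +
        (levelPoint μ K ρ (ϑ + θ) - levelPoint μ K ρ (ϑ₁ + θ)) - (levelPoint μ K 0 (φ + θ) - levelPoint μ K 0 (φ₁ + θ)) := by abel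
  rw [hid]
  calc _ ≤ ‖(c + (levelPoint μ K ρ (ϑ₁ + θ) - levelPoint μ K 0 (φ₁ + θ)) - levelPoint μ K 0 (φ₁ + θ)) +
          (levelPoint μ K ρ (ϑ + θ) - levelPoint μ K ρ (ϑ₁ + θ))‖ + ‖levelPoint μ K 0 (φ + θ) - levelPoint μ K 0 (φ₁ + θ)‖ := norm_sub_le _ _
    _ ≤ ‖c + (levelPoint μ K ρ (ϑ₁ + θ) - levelPoint μ K 0 (φ₁ + θ)) - levelPoint μ K 0 (φ₁ + θ)‖ +
          ‖levelPoint μ K ρ (ϑ + θ) - levelPoint μ K ρ (ϑ₁ + θ)‖ + ‖levelPoint μ K 0 (φ + θ) - levelPoint μ K 0 (φ₁ + θ)‖ := by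
        gcongr; exact norm_add_le _ _
    _ ≤ τ₀ + msD A₃ A₄ 1 * |ϑ - ϑ₁| + msD A₃ A₄ 1 * |φ - φ₁| := by linarith

omit hr hK₁ in
/-- **The `hΔ` row on the box** `[α,β] × [φa,φb]` containing the witness: `Δ = τ₀ + msD₁·((β − α) + (φb − φa))`. -/
theorem norm_partnerBand_sub_loopPoint_le_of_nearCaustic_box {ρ : ℝ} (hρ : |ρ| < r) (c : Momentum) (θ : ℝ) {α β φa φb ϑ₁ φ₁ τ₀ : ℝ}
    (hϑ₁ : ϑ₁ ∈ Icc α β) (hφ₁ : φ₁ ∈ Icc φa φb)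
    (hτ : ‖c + (levelPoint μ K ρ (ϑ₁ + θ) - levelPoint μ K 0 (φ₁ + θ)) - levelPoint μ K 0 (φ₁ + θ)‖ ≤ τ₀) :
    ∀ x ∈ Icc α β ×ˢ Icc φa φb, ‖c + (levelPoint μ K ρ (x.1 + θ) - levelPoint μ K 0 (x.2 + θ)) - levelPoint μ K 0 (φ₁ + θ)‖ ≤
      τ₀ + msD A₃ A₄ 1 * ((β - α) + (φb - φa)) := by
  intro x hx
  have h := norm_partnerBand_sub_loopPoint_le_of_nearCaustic hA hA20 hd hlo hhi hA₃ hA₄ hρ c θ hτ x.1 x.2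
  have hM : 0 ≤ msD A₃ A₄ 1 := (norm_nonneg _).trans (norm_iteratedDeriv_levelPoint_le hA hA20 hd hlo hhi hA₃ hA₄ hρ le_rfl (by norm_num) 0)
  have h1 : |x.1 - ϑ₁| ≤ β - α := abs_sub_le_iff.2 ⟨by linarith [hx.1.2, hϑ₁.1], by linarith [hx.1.1, hϑ₁.2]⟩
  have h2 : |x.2 - φ₁| ≤ φb - φa := abs_sub_le_iff.2 ⟨by linarith [hx.2.2, hφ₁.1], by linarith [hx.2.1, hφ₁.2]⟩
  have := mul_le_mul_of_nonneg_left h1 hM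
  have := mul_le_mul_of_nonneg_left h2 hM
  nlinarith

/-! ### §3 Same direction is empty on umklapp sheets -/

omit hK₁ in
/-- **AN UMKLAPP NEAR-CAUSTIC CONFIGURATION IS NEVER `q′`-DIRECTED.**  Sheet `m ≠ 0`, `|ρ| < r`; witness `‖S(ϑ₁) − 2πm − 2Φ(0,φ₁+θ)‖ ≤ τ₀`
(`S(ϑ₁) = Φ(0,θ) + Φ(ρ,ϑ₁+θ)`); if the angle `ϑ₁ + θ` of `q′` is within `η₀` of the loop angle `φ₁ + θ` on the torus and `τ₀ + 2(msD₁·η₀ + |ρ|/(Dt−2A)) ≤ 3/5`,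
contradiction (`lt_caustic_dist_add_two_norm_sub`: `3/5 < ‖S − 2p − 2πm‖ + 2‖p − q′‖`, and `‖p − q′‖ ≤ msD₁‖φ₁ − ϑ₁‖_𝕋 + |ρ|/(Dt−2A)`). -/
theorem not_nearCaustic_sameDirection {ρ : ℝ} (hρ : |ρ| < r) (θ : ℝ) {m : Fin 2 → ℤ} (hm : m ≠ 0) {ϑ₁ φ₁ τ₀ η₀ : ℝ}
    (hτ : ‖pairSumPath μ K ρ ϑ₁ θ 0 - WithLp.toLp 2 (fun i => 2 * π * (m i : ℝ)) - (2 : ℝ) • levelPoint μ K 0 (φ₁ + θ)‖ ≤ τ₀)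
    (hsame : torusDist (ϑ₁ - φ₁) ≤ η₀)
    (hsmall : τ₀ + 2 * (msD A₃ A₄ 1 * η₀ + |ρ| / ((bandBounds (show (-4 : ℝ) < -1.1 by norm_num) (show (-1.1 : ℝ) ≤ -0.1 by norm_num)
      (show (-0.1 : ℝ) < 0 by norm_num)).Dtmin - 2 * A)) ≤ 3 / 5) : False := by
  set B := bandBounds (show (-4 : ℝ) < -1.1 by norm_num) (show (-1.1 : ℝ) ≤ -0.1 by norm_num) (show (-0.1 : ℝ) < 0 by norm_num) with hBdef
  have hADt : 2 * A < B.Dtmin := by have := klCurveD_pos; linarith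
  have h0 : |(0 : ℝ)| < r := by simpa using hr
  have hρI : ρ ∈ Ioo (-r) r := ⟨(abs_lt.1 hρ).1, (abs_lt.1 hρ).2⟩
  have h0I : (0 : ℝ) ∈ Ioo (-r) r := ⟨by linarith, hr⟩
  have hM : 0 ≤ msD A₃ A₄ 1 := (norm_nonneg _).trans (norm_iteratedDeriv_levelPoint_le hA hA20 hd hlo hhi hA₃ hA₄ hρ le_rfl (by norm_num) 0)
  -- the 3/5 margin
  have hmar := lt_caustic_dist_add_two_norm_sub hA hlo hhi hr hρ 0 ϑ₁ θ (φ₁ + θ) hm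
  have e1 : pairSumPath μ K ρ ϑ₁ θ 0 - levelPoint μ K 0 (φ₁ + θ) - levelPoint μ K 0 (φ₁ + θ) - WithLp.toLp 2 (fun i => 2 * π * (m i : ℝ)) =
      pairSumPath μ K ρ ϑ₁ θ 0 - WithLp.toLp 2 (fun i => 2 * π * (m i : ℝ)) - (2 : ℝ) • levelPoint μ K 0 (φ₁ + θ) := by
    rw [two_smul]; abel
  rw [e1] at hmar
  -- `‖p − q′‖ ≤ msD₁‖φ₁ − ϑ₁‖_𝕋 + |ρ|/(Dt − 2A)`
  have hpq : ‖levelPoint μ K 0 (φ₁ + θ) - levelPoint μ K ρ (ϑ₁ + θ)‖ ≤ msD A₃ A₄ 1 * η₀ + |ρ| / (B.Dtmin - 2 * A) := by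
    have h1 := norm_levelPoint_sub_le_torusDist hA hA20 hd hlo hhi hA₃ hA₄ h0 (φ₁ + θ) (ϑ₁ + θ)
    rw [show φ₁ + θ - (ϑ₁ + θ) = -(ϑ₁ - φ₁) by ring, torusDist_neg'] at h1
    have h2 := norm_levelPoint_sub_levelPoint_le B hA hADt hlo hhi h0I hρI (ϑ₁ + θ)
    rw [zero_sub, abs_neg] at h2
    calc ‖levelPoint μ K 0 (φ₁ + θ) - levelPoint μ K ρ (ϑ₁ + θ)‖
        ≤ ‖levelPoint μ K 0 (φ₁ + θ) - levelPoint μ K 0 (ϑ₁ + θ)‖ + ‖levelPoint μ K 0 (ϑ₁ + θ) - levelPoint μ K ρ (ϑ₁ + θ)‖ := norm_sub_le_norm_sub_add_norm_sub _ _ _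
      _ ≤ msD A₃ A₄ 1 * torusDist (ϑ₁ - φ₁) + |ρ| / (B.Dtmin - 2 * A) := add_le_add h1 h2
      _ ≤ msD A₃ A₄ 1 * η₀ + |ρ| / (B.Dtmin - 2 * A) := by have := mul_le_mul_of_nonneg_left hsame hM; linarith
  linarith

/-! ### §4 Transversal: the partner is a direct chart point; the configuration-rate floor near the reference angle -/

omit hA20 hr hA₃ hA₄ in
/-- **THE PARTNER IS THE DIRECT CHART POINT OF ITS OWN LEVEL, NEAR THE REFERENCE ANGLE.**  If `‖P − Φ(0,ψ)‖ ≤ Δ` with `Δ ≤ 3/10` and `K₁Δ < r`, then `P = Φ(e_K P, ψ′)` with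
`|e_K P| ≤ K₁Δ` and `(2u_min/π)‖ψ′ − ψ‖_𝕋 ≤ Δ`. -/
theorem exists_chart_of_norm_sub_levelPoint_le {P : Momentum} {ψ Δ : ℝ} (hP : ‖P - levelPoint μ K 0 ψ‖ ≤ Δ) (hΔ : Δ ≤ 3 / 10) (hΔr : K₁ * Δ < r) :
    ∃ ψ' : ℝ, P = levelPoint μ K (frameLevel μ K P) ψ' ∧ |frameLevel μ K P| ≤ K₁ * Δ ∧
      2 * (bandBounds (show (-4 : ℝ) < -1.1 by norm_num) (show (-1.1 : ℝ) ≤ -0.1 by norm_num) (show (-0.1 : ℝ) < 0 by norm_num)).umin / π *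
        torusDist (ψ' - ψ) ≤ Δ := by
  set B := bandBounds (show (-4 : ℝ) < -1.1 by norm_num) (show (-1.1 : ℝ) ≤ -0.1 by norm_num) (show (-0.1 : ℝ) < 0 by norm_num) with hBdef
  have hADt : 2 * A < B.Dtmin := by have := klCurveD_pos; linarith
  have hK0 : 0 ≤ K₁ := (norm_nonneg _).trans (hK₁ 0)
  have hΔ0 : 0 ≤ Δ := (norm_nonneg _).trans hP
  have hr' : 0 < r := lt_of_le_of_lt (mul_nonneg hK0 hΔ0) hΔr
  have h0 : |(0 : ℝ)| < r := by simpa using hr'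
  -- the level
  have hlo₀ : (-1.1 : ℝ) ≤ μ + 0 - A := by linarith
  have hhi₀ : μ + 0 + A ≤ -0.1 := by linarith
  have hlev : |frameLevel μ K P| ≤ K₁ * Δ := by
    have h := abs_frameLevel_sub_le hK₁ P (levelPoint μ K 0 ψ)
    rw [frameLevel_levelPoint B hA hlo₀ hhi₀ ψ, sub_zero] at h
    exact h.trans (mul_le_mul_of_nonneg_left hP hK0)
  have hlevr : |frameLevel μ K P| < r := lt_of_le_of_lt hlev hΔr
  -- the open zone: `|P_i| ≤ |Φ(0,ψ)_i| + Δ < π − 3/10 + 3/10`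
  have hsq : ∀ i, |P i| < π := fun i => by
    have h1 := abs_levelPoint_apply_lt hA hlo hhi h0 ψ i
    have h2 : |(P - levelPoint μ K 0 ψ) i| ≤ Δ := by
      have := PiLp.norm_apply_le (P - levelPoint μ K 0 ψ) i
      rw [Real.norm_eq_abs] at this
      exact this.trans hP
    rw [PiLp.sub_apply] at h2
    have := abs_sub_abs_le_abs_sub (P i) (levelPoint μ K 0 ψ i)
    linarith
  obtain ⟨ψ', -, hPeq⟩ := exists_levelPoint_eq_of_abs_frameLevel_lt B hA hADt hlo.le hhi.le hlevr hsq
  refine ⟨ψ', hPeq, hlev, ?_⟩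
  -- the angle, by the lower chord bound at levels `e_K P` and `0`
  have hloP : (-1.1 : ℝ) ≤ μ + frameLevel μ K P - A := by have := (abs_lt.1 hlevr).1; linarith
  have hhiP : μ + frameLevel μ K P + A ≤ -0.1 := by have := (abs_lt.1 hlevr).2; linarith
  have h := norm_levelPoint_sub_ge_torusDist B hA hloP hhiP hlo₀ hhi₀ ψ' ψ
  rw [← hPeq] at h
  exact h.trans hP

omit hA20 hr hA₃ hA₄ in
/-- **CONFIGURATION-RATE FLOOR NEAR A REFERENCE ANGLE** (the Gauss law at the partner's own chart point, transported to the reference angle `ψ`).  Under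
`GeomConstants (frameLevel μ K) Kc r₀ g₀ w`, if `‖P − Φ(0,ψ)‖ ≤ Δ` (`Δ ≤ 3/10`, `K₁Δ < r`), `|ρ| < r`, `|ρ| < r₀`, and `η ≤ min(‖ψ − χ‖_𝕋, ‖ψ − χ − π‖_𝕋)`, then
`(2/π)(Dt−2A)u_min·((u_min w/(4+2A))(η − (π/(2u_min))Δ) − πKc(K₁Δ + |ρ|)/(Dt−2A)²) ≤ |De_K(P)[∂_sΦ(ρ,χ)]|`. [cite: BenfattoGiulianiMastropietro2003, §7.1 Lemma 7.1 (A1.9)] -/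
theorem abs_configRate_ge_of_near {Kc r₀ g₀ w : ℝ} (hG : GeomConstants (frameLevel μ K) Kc r₀ g₀ w) {P : Momentum} {ψ Δ : ℝ}
    (hP : ‖P - levelPoint μ K 0 ψ‖ ≤ Δ) (hΔ : Δ ≤ 3 / 10) (hΔr : K₁ * Δ < r) {ρ : ℝ} (hρ : |ρ| < r) (hρ₀ : |ρ| < r₀) {χ η : ℝ}
    (hη : η ≤ min (torusDist (ψ - χ)) (torusDist (ψ - χ - π))) :
    2 / π * (((bandBounds (show (-4 : ℝ) < -1.1 by norm_num) (show (-1.1 : ℝ) ≤ -0.1 by norm_num) (show (-0.1 : ℝ) < 0 by norm_num)).Dtmin - 2 * A) *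
        (bandBounds (show (-4 : ℝ) < -1.1 by norm_num) (show (-1.1 : ℝ) ≤ -0.1 by norm_num) (show (-0.1 : ℝ) < 0 by norm_num)).umin) *
      ((bandBounds (show (-4 : ℝ) < -1.1 by norm_num) (show (-1.1 : ℝ) ≤ -0.1 by norm_num) (show (-0.1 : ℝ) < 0 by norm_num)).umin * w /
            (4 + 2 * A) *
          (η - π / (2 * (bandBounds (show (-4 : ℝ) < -1.1 by norm_num) (show (-1.1 : ℝ) ≤ -0.1 by norm_num) (show (-0.1 : ℝ) < 0 by norm_num)).umin) * Δ) -
        π * Kc * (K₁ * Δ + |ρ|) / ((bandBounds (show (-4 : ℝ) < -1.1 by norm_num) (show (-1.1 : ℝ) ≤ -0.1 by norm_num)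
          (show (-0.1 : ℝ) < 0 by norm_num)).Dtmin - 2 * A) ^ 2) ≤
      |fderiv ℝ (frameLevel μ K) P (iteratedDeriv 1 (levelPoint μ K ρ) χ)| := by
  set B := bandBounds (show (-4 : ℝ) < -1.1 by norm_num) (show (-1.1 : ℝ) ≤ -0.1 by norm_num) (show (-0.1 : ℝ) < 0 by norm_num) with hBdef
  obtain ⟨ψ', hPeq, hlev, hang⟩ := exists_chart_of_norm_sub_levelPoint_le hA hd hlo hhi hK₁ hP hΔ hΔr
  have hlevr : |frameLevel μ K P| < r := lt_of_le_of_lt hlev hΔr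
  -- the Gauss law at the partner's own chart point
  have hgauss := abs_fderiv_frameLevel_levelPoint_tangent_ge hA hd hlo hhi hG hlevr hρ hρ₀ ψ' χ
  rw [← hPeq] at hgauss
  refine le_trans ?_ hgauss
  -- monotonicity of the floor in (angle, level gap)
  have hA0 : 0 ≤ A := (norm_nonneg _).trans (hA 0 0 (by norm_num))
  have hDt : 0 < B.Dtmin - 2 * A := by have := klCurveD_pos; linarith
  have hu : 0 < B.umin := B.umin_pos
  have hw : 0 < w := hG.wmin_pos
  have hKc : 0 ≤ Kc := le_trans (norm_nonneg _) (hG.norm_iteratedFDeriv_le (0 : Momentum) 0 (by norm_num))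
  have hcK : 0 ≤ B.umin * w / (4 + 2 * A) := by positivity
  -- angle: `min(‖ψ′−χ‖, ‖ψ′−χ−π‖) ≥ min(‖ψ−χ‖, ‖ψ−χ−π‖) − ‖ψ′−ψ‖ ≥ η − (π/(2u))Δ`
  have hang' : torusDist (ψ' - ψ) ≤ π / (2 * B.umin) * Δ := by
    rw [div_mul_eq_mul_div, le_div_iff₀ (by positivity)]
    have := hang
    rw [div_mul_eq_mul_div, div_le_iff₀ Real.pi_pos] at this
    linarith
  have hmin : η - π / (2 * B.umin) * Δ ≤ min (torusDist (ψ' - χ)) (torusDist (ψ' - χ - π)) := by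
    have h := min_torusDist_add_ge (ψ - χ) (ψ' - ψ)
    rw [show ψ - χ + (ψ' - ψ) = ψ' - χ by ring] at h
    linarith
  -- level gap: `|e_K P − ρ| ≤ K₁Δ + |ρ|`
  have hgap : |frameLevel μ K P - ρ| ≤ K₁ * Δ + |ρ| := (abs_sub _ _).trans (add_le_add hlev le_rfl)
  have h1 : B.umin * w / (4 + 2 * A) * (η - π / (2 * B.umin) * Δ) ≤ B.umin * w / (4 + 2 * A) * min (torusDist (ψ' - χ)) (torusDist (ψ' - χ - π)) :=
    mul_le_mul_of_nonneg_left hmin hcK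
  have h2 : π * Kc * |frameLevel μ K P - ρ| / (B.Dtmin - 2 * A) ^ 2 ≤ π * Kc * (K₁ * Δ + |ρ|) / (B.Dtmin - 2 * A) ^ 2 :=
    div_le_div_of_nonneg_right (mul_le_mul_of_nonneg_left hgap (by positivity)) (by positivity)
  have h3 : 0 ≤ 2 / π * ((B.Dtmin - 2 * A) * B.umin) := by positivity
  have := mul_le_mul_of_nonneg_left (sub_le_sub h1 h2) h3
  linarith

/-! ### §5 The antipodal alternative, assembled -/

omit hr hK₁ in
/-- **THE ANTIPODAL ALTERNATIVE, ASSEMBLED**: a near-caustic box (`‖c + Φ(ρ,ϑ₁+θ) − 2Φ(0,φ₁+θ)‖ ≤ τ₀` at some `(ϑ₁,φ₁)` of the box) whose `q′`-angle is within `η₀`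
of the antipode of the loop angle (`‖ϑ₁ − φ₁ − π‖_𝕋 ≤ η₀`) carries, for an integer `j` and the reference angle `ψ′ = φ₁ + θ + 2πj`, the three rows of
`intervalIntegral_caustic_dispatch_partnerBand(_sInf)_le` on the SHIFTED loop window `[φa + 2πj, φb + 2πj]`: `hΔ` with `Δ = τ₀ + msD₁((β−α) + (φb−φa))`,
`hω₁` with `η₀ + (β − α)`, `hω₂` with `φb − φa` — and the canonical offset over the shifted window equals the one over `[φa,φb]`
(`sInf_partnerBand_image_Icc_add_shift`). -/
theorem exists_antipodal_rows_of_nearCaustic {ρ : ℝ} (hρ : |ρ| < r) (c : Momentum) (θ : ℝ) {α β φa φb ϑ₁ φ₁ τ₀ η₀ : ℝ}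
    (hϑ₁ : ϑ₁ ∈ Icc α β) (hφ₁ : φ₁ ∈ Icc φa φb)
    (hτ : ‖c + (levelPoint μ K ρ (ϑ₁ + θ) - levelPoint μ K 0 (φ₁ + θ)) - levelPoint μ K 0 (φ₁ + θ)‖ ≤ τ₀)
    (hanti : torusDist (ϑ₁ - φ₁ - π) ≤ η₀) :
    ∃ j : ℤ,
      (∀ x ∈ Icc α β ×ˢ Icc (φa + 2 * π * j) (φb + 2 * π * j),
          ‖c + (levelPoint μ K ρ (x.1 + θ) - levelPoint μ K 0 (x.2 + θ)) - levelPoint μ K 0 (φ₁ + θ + 2 * π * j)‖ ≤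
            τ₀ + msD A₃ A₄ 1 * ((β - α) + (φb - φa))) ∧
        (∀ ϑ ∈ Icc α β, |ϑ + θ - (φ₁ + θ + 2 * π * j + π)| ≤ η₀ + (β - α)) ∧
        (∀ φ ∈ Icc (φa + 2 * π * j) (φb + 2 * π * j), |φ + θ - (φ₁ + θ + 2 * π * j)| ≤ φb - φa) := by
  have hanti' : torusDist (ϑ₁ + θ - (φ₁ + θ) - π) ≤ η₀ := by rwa [show ϑ₁ + θ - (φ₁ + θ) - π = ϑ₁ - φ₁ - π by ring]
  obtain ⟨j, hj⟩ := exists_shift_of_torusDist_antipodal hϑ₁ hanti'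
  have hbox := norm_partnerBand_sub_loopPoint_le_of_nearCaustic_box hA hA20 hd hlo hhi hA₃ hA₄ hρ c θ hϑ₁ hφ₁ hτ
  have hω₂ : ∀ φ ∈ Icc φa φb, |φ + θ - (φ₁ + θ)| ≤ φb - φa := fun φ hφ => by
    rw [show φ + θ - (φ₁ + θ) = φ - φ₁ by ring]
    exact abs_sub_le_iff.2 ⟨by linarith [hφ.2, hφ₁.1], by linarith [hφ.1, hφ₁.2]⟩
  have hsh := partnerBand_rows_shift (μ := μ) (K := K) ρ c θ (φ₁ + θ) j hbox hω₂
  exact ⟨j, hsh.1, hj, hsh.2⟩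
end Sizes

end Summit.HubbardSuperconductivity.HubbardSuperconductivity.Theorems.C4a

end
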